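import Mathlib
import Summits.ValiantsHypothesis.ValiantsHypothesis.Theorems.LacunarySymmetroidMatrixDescartesOneSidedExact
import Summits.ValiantsHypothesis.ValiantsHypothesis.Theorems.LacunarySymmetroidMatrixDescartesGramDualRankMDR

/-!
# `MatrixDescartes` (stmt-ValiantsHypothesis-18050) — THE ONE-SIDED RUNG IS EXACT, IN THE CRUX'S CURRENCY: a pencil
# `Σ_l X^{d_l} S_l` with a non-degenerate letter `S_{l₀}` and PSD letters at larger exponents has EXACTLY
# `ν([S_k S_{l₀}⁻¹ S_l]_{k,l≠l₀})` positive zeros counted with multiplicity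

HONEST FRAMING.  Cell `pub-symmetroid`, seat `val-sym-mdr-p2` (gen 20); helper file `--supports` the crux
`Theses.LacunarySymmetroid.MatrixDescartes` (OPEN), NO closure claim; the pencil-currency form of `…OneSidedExact`
(`GramDual.card_posRoots_multiset_eq_negIndex_gram`: one-sided PSD words have exactly `ν(UᵀB⁻¹U)` positive zeros with
multiplicity) through `…GramDualPencil` (signed column form) and `…GramDualRankMDR` (the eigen-column system and the raw
column system factor through each other).  The EXACT form of the tree's first rung (`firstRung_oneSided`, `Z₊ ≤ m`) on
the non-degenerate-base part of its sector; nothing here bears on the crux in its window, `stub_twoSided`,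
`DoorA26` / `DoorA34`, registers, or `VP ≠ VNP`.

* `negIndex_gram_eq_negIndex_blockGram` — the negative index of the eigen-column Gram matrix `𝔾` equals that of the BLOCK
  GRAM MATRIX `[S_k S_{l₀}⁻¹ S_l]_{k,l≠l₀}` (rectangular Sylvester both ways), so the count is eigenvector-free.
* **`oneSided_pencil_card_posRoots_multiset_eq` (THE EXACT ONE-SIDED RUNG).**  Real symmetric letters, `det S_{l₀} ≠ 0`,
  every other letter PSD with `d_l > d_{l₀}`: the positive zeros of `det(Σ_l X^{d_l}S_l)` counted with multiplicity number
  EXACTLY `ν(𝔾) = ν([S_kS_{l₀}⁻¹S_l]_{k,l≠l₀})`; `…_eq_negIndex_blockGram` (block form), `oneSided_pencil_card_posRoots_le_negIndex`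
  (distinct zeros `≤`), `…_le_negIndex_base` (`≤ ν(S_{l₀})`, with multiplicity).  So on this sector `Z₊` is decided by
  ONE inertia computation on a `(K−1)m × (K−1)m` real matrix; `ν = 0` (the joint range `S_{l₀}⁻¹`-nonnegative) ⇔ sterile.

[folklore] (Sylvester's law of inertia; spectral theorem).  Axioms `propext`, `Classical.choice`, `Quot.sound`.
-/

-- layout Summits/ValiantsHypothesis/ValiantsHypothesis forces the duplicated namespace component
set_option linter.dupNamespace false

namespace Summit.ValiantsHypothesis.ValiantsHypothesis.Theorems.LacunarySymmetroidMatrixDescartes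

open Polynomial Matrix Finset
open scoped BigOperators

namespace GramDual

section OneSidedPencil

variable {K m : ℕ} (d : Fin K → ℕ) (S : Fin K → Matrix (Fin m) (Fin m) ℝ) (hS : ∀ l, (S l).IsHermitian) (l₀ : Fin K)

/-- the column type: non-zero eigen-columns of the letters `l ≠ l₀` (file-local notation, as in `…GramDualRank`) -/
local notation3 (prettyPrint := false) "𝕋" =>
  {li : Fin K × Fin m // li.1 ≠ l₀ ∧ (hS li.1).eigenvalues li.2 ≠ 0}

/-- the eigen-column matrix (file-local notation, as in `…GramDualRank`) -/
local notation3 (prettyPrint := false) "𝕌" =>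
  (Matrix.of fun (a : Fin m) (t : 𝕋) => ((hS t.1.1).eigenvectorUnitary : Matrix (Fin m) (Fin m) ℝ) a t.1.2)

/-- the Gram matrix of the eigen-columns (file-local notation, as in `…GramDualRank`) -/
local notation3 (prettyPrint := false) "𝔾" => ((𝕌)ᵀ * (S l₀)⁻¹ * (𝕌))

/-- the raw column matrix (file-local notation, as in `…GramDualRankMDR`) -/
local notation3 (prettyPrint := false) "𝕎" =>
  (Matrix.of fun (a : Fin m) (p : {l : Fin K // l ≠ l₀} × Fin m) => S p.1.1 a p.2)

/-- the block Gram matrix `[S_k S_{l₀}⁻¹ S_l]_{k,l≠l₀}` (file-local notation, as in `…GramDualRankMDR`) -/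
local notation3 (prettyPrint := false) "𝒢" => ((𝕎)ᵀ * (S l₀)⁻¹ * 𝕎)

/-! ## §1  The negative index of the Gram matrix is intrinsic -/

include hS in
/-- The block Gram matrix is hermitian (symmetric base). [folklore] -/
theorem isHermitian_blockGram : (𝒢).IsHermitian :=
  isHermitian_gram (isSymm_of_isHermitian_real (hS l₀)) _

/-- **`ν(𝔾) = ν([S_kS_{l₀}⁻¹S_l])`**: the negative index of the eigen-column Gram matrix is that of the block Gram matrix of
the raw letter columns. [folklore] -/
theorem negIndex_gram_eq_negIndex_blockGram :
    Fintype.card {j // (isHermitian_pencilGram S hS l₀).eigenvalues j < 0}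
      = Fintype.card {j // (isHermitian_blockGram S hS l₀).eigenvalues j < 0} := by
  classical
  have hinv : ((S l₀)⁻¹).IsHermitian := Inertia.isHermitian_of_isSymm (isSymm_inv (isSymm_of_isHermitian_real (hS l₀)))
  apply le_antisymm
  · -- `𝔾 = Mᵀ 𝒢 M`
    set M := Matrix.of (fun (p : {l : Fin K // l ≠ l₀} × Fin m) (t : 𝕋) =>
      if p.1.1 = t.1.1 then ⇑((hS t.1.1).eigenvectorBasis t.1.2) p.2 / (hS t.1.1).eigenvalues t.1.2 else 0) with hM
    have hU : (𝕌) = 𝕎 * M := eigenCols_eq_blockCols_mul S hS l₀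
    have hG : (𝔾) = Mᵀ * (𝒢) * M := by
      rw [hU, Matrix.transpose_mul]
      simp only [Matrix.mul_assoc]
    have hGH : (Mᵀ * (𝒢) * M).IsHermitian := by rw [← hG]; exact isHermitian_pencilGram S hS l₀
    rw [Inertia.negIndex_congr (isHermitian_pencilGram S hS l₀) hGH hG]
    exact negIndex_conj_le (isHermitian_blockGram S hS l₀) M hGH
  · -- `𝒢 = Nᵀ 𝔾 N`
    set N := Matrix.of (fun (t : 𝕋) (p : {l : Fin K // l ≠ l₀} × Fin m) =>
      if t.1.1 = p.1.1 then (hS t.1.1).eigenvalues t.1.2 * ⇑((hS t.1.1).eigenvectorBasis t.1.2) p.2 else 0) with hN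
    have hW : 𝕎 = (𝕌) * N := blockCols_eq_eigenCols_mul S hS l₀
    have hG : (𝒢) = Nᵀ * (𝔾) * N := by
      rw [hW, Matrix.transpose_mul]
      simp only [Matrix.mul_assoc]
    have hGH : (Nᵀ * (𝔾) * N).IsHermitian := by rw [← hG]; exact isHermitian_blockGram S hS l₀
    rw [Inertia.negIndex_congr (isHermitian_blockGram S hS l₀) hGH hG]
    exact negIndex_conj_le (isHermitian_pencilGram S hS l₀) N hGH

/-! ## §2  The exact one-sided rung for pencils -/

/-- **THE ONE-SIDED RUNG IS EXACT (crux currency, Gram form).**  `det S_{l₀} ≠ 0`, all other letters PSD with `d_l > d_{l₀}`: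
the positive zeros of `det(Σ_l X^{d_l} S_l)` counted with multiplicity number exactly `ν(𝔾)`. [folklore] -/
theorem oneSided_pencil_card_posRoots_multiset_eq (hS₀ : IsUnit (S l₀).det) (hpsd : ∀ l, l ≠ l₀ → (S l).PosSemidef)
    (hd : ∀ l, l ≠ l₀ → d l₀ < d l) :
    Multiset.card ((Matrix.det (∑ l, ((Polynomial.X : Polynomial ℝ) ^ d l) • (S l).map Polynomial.C)).roots.filter
        (fun t => 0 < t))
      = Fintype.card {j // (isHermitian_pencilGram S hS l₀).eigenvalues j < 0} := by
  classical
  rw [pencil_eq_base_add_signedPart d S hS l₀]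
  exact card_posRoots_multiset_eq_negIndex_gram (S l₀) (isSymm_of_isHermitian_real (hS l₀)) hS₀ (𝕌)
    (fun t : 𝕋 => (hS t.1.1).eigenvalues t.1.2)
    (fun t => lt_of_le_of_ne (eigenvalues_nonneg_of_posSemidef' (hS t.1.1) (hpsd t.1.1 t.2.1) t.1.2) (Ne.symm t.2.2))
    (d l₀) (fun t : 𝕋 => d t.1.1) (fun t => hd t.1.1 t.2.1) (isHermitian_pencilGram S hS l₀)

/-- **THE ONE-SIDED RUNG IS EXACT (crux currency, block form)**: the count is `ν([S_kS_{l₀}⁻¹S_l]_{k,l≠l₀})` — one inertia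
computation, no eigenvectors. [folklore] -/
theorem oneSided_pencil_card_posRoots_multiset_eq_negIndex_blockGram (hS₀ : IsUnit (S l₀).det)
    (hpsd : ∀ l, l ≠ l₀ → (S l).PosSemidef) (hd : ∀ l, l ≠ l₀ → d l₀ < d l) :
    Multiset.card ((Matrix.det (∑ l, ((Polynomial.X : Polynomial ℝ) ^ d l) • (S l).map Polynomial.C)).roots.filter
        (fun t => 0 < t))
      = Fintype.card {j // (isHermitian_blockGram S hS l₀).eigenvalues j < 0} := by
  rw [oneSided_pencil_card_posRoots_multiset_eq d S hS l₀ hS₀ hpsd hd, negIndex_gram_eq_negIndex_blockGram S hS l₀]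

/-- **Distinct zeros**: `Z₊ ≤ ν([S_kS_{l₀}⁻¹S_l])` on the one-sided sector. [folklore] -/
theorem oneSided_pencil_card_posRoots_le_negIndex (hS₀ : IsUnit (S l₀).det) (hpsd : ∀ l, l ≠ l₀ → (S l).PosSemidef)
    (hd : ∀ l, l ≠ l₀ → d l₀ < d l) :
    ((Matrix.det (∑ l, ((Polynomial.X : Polynomial ℝ) ^ d l) • (S l).map Polynomial.C)).roots.toFinset.filter
        (fun t => 0 < t)).card
      ≤ Fintype.card {j // (isHermitian_blockGram S hS l₀).eigenvalues j < 0} := by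
  classical
  rw [← oneSided_pencil_card_posRoots_multiset_eq_negIndex_blockGram d S hS l₀ hS₀ hpsd hd, ← Multiset.toFinset_filter]
  exact Multiset.toFinset_card_le _

/-- **`Z₊ ≤ ν(S_{l₀})` with multiplicity** on the one-sided sector — the tree's rung `Z₊ ≤ m` sharpened to the negative
index of the base letter. [folklore] -/
theorem oneSided_pencil_card_posRoots_multiset_le_negIndex_base (hS₀ : IsUnit (S l₀).det)
    (hpsd : ∀ l, l ≠ l₀ → (S l).PosSemidef) (hd : ∀ l, l ≠ l₀ → d l₀ < d l) :
    Multiset.card ((Matrix.det (∑ l, ((Polynomial.X : Polynomial ℝ) ^ d l) • (S l).map Polynomial.C)).roots.filter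
        (fun t => 0 < t))
      ≤ Fintype.card {j // (hS l₀).eigenvalues j < 0} := by
  rw [oneSided_pencil_card_posRoots_multiset_eq d S hS l₀ hS₀ hpsd hd]
  exact negIndex_gram_le (isSymm_of_isHermitian_real (hS l₀)) hS₀ (hS l₀) _ (isHermitian_pencilGram S hS l₀)

end OneSidedPencil

end GramDual

end Summit.ValiantsHypothesis.ValiantsHypothesis.Theorems.LacunarySymmetroidMatrixDescartes
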